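import Summits.Ventures.AbcSig.Rows.StatementsC1b
import Summits.Ventures.AbcSig.Rows.XnA7Yn33Z2X

/-!
# Venture AbcSig — CELL bridge for `xⁿ + 2^α yⁿ = 33 z²` (FAMILY C1b, `7 ≤ α < n (reduced, RULING H1)`): p1's census predicate `Rows.C1bCell 33 Rows.AlphaGe7Reduced 11 ∅`

HONEST FRAMING. COMPUTATION cell `pub-abcsig`; CONDITIONAL theorem; no claim on ABC or any summit. Hypotheses exactly
those of `Rows/XnA7Yn33Z2X.lean` (`xrow_XnA7Yn33Z2`): `BS04Package` (CITED), `DataComplete` at the two levels (COMPUTED, certified level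
files) and the row's per-orbit CITED exclusions `hX_…`, universally quantified in the exponent. Conclusion = the conjunct
`Rows.C1bCell 33 Rows.AlphaGe7Reduced 11 ∅` of p1's `Rows.C1bSmallAlphaSigned` / `Rows.C1bExtSigned`
(`Rows/StatementsC1b.lean`; row of record `census/rows/C1b/C1b-C33-a7plus.md`, R8-signed): every prime `n ≥ 11`, `n ∤ 33`,
`7 ≤ α < n (reduced, RULING H1)`, no primitive solution with `|xy| > 1`. GENERATED by p-lean gen3/make_c1bcell.py (pattern of `Rows/Xn8Yn11Z2Cell.lean`).
-/

namespace Summit.Ventures.AbcSig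

/-- `xⁿ + 2^α yⁿ = 33z²` (`7 ≤ α < n (reduced, RULING H1)`), every prime `n ≥ 11` with `n ∤ 33`, `|xy| > 1`: p1's conjunct
`Rows.C1bCell 33 Rows.AlphaGe7Reduced 11 ∅` from `xrow_XnA7Yn33Z2`. -/
theorem C1bCell_33_a7plus_of (M : NewformModel) (hP : M.BS04Package)
    (hD2178 : M.DataComplete 2178 level2178Orbits)
    (hX_orbit_2178_1 : ∀ n : ℕ, M.Excludes 2178 orbit_2178_1 (famBCge7 33 n))
    (hX_orbit_2178_8 : ∀ n : ℕ, M.Excludes 2178 orbit_2178_8 (famBCge7 33 n))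
    (hX_orbit_2178_9 : ∀ n : ℕ, M.Excludes 2178 orbit_2178_9 (famBCge7 33 n))
    (hX_orbit_2178_10 : ∀ n : ℕ, M.Excludes 2178 orbit_2178_10 (famBCge7 33 n))
    (hX_orbit_2178_11 : ∀ n : ℕ, M.Excludes 2178 orbit_2178_11 (famBCge7 33 n))
    (hX_orbit_2178_12 : ∀ n : ℕ, M.Excludes 2178 orbit_2178_12 (famBCge7 33 n))
    (hX_orbit_2178_13 : ∀ n : ℕ, M.Excludes 2178 orbit_2178_13 (famBCge7 33 n)) :
    Rows.C1bCell 33 Rows.AlphaGe7Reduced 11 ∅ := by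
  intro n hn h0 hC _ α hα x y z h1 h2
  exact xrow_XnA7Yn33Z2 M hP hD2178 n hn h0 (by
      intro hmem
      simp only [List.mem_cons, List.not_mem_nil, or_false] at hmem
      subst hmem
      exact hC (by norm_num)) α hα.1 hα.2 (hX_orbit_2178_1 n) (hX_orbit_2178_8 n) (hX_orbit_2178_9 n) (hX_orbit_2178_10 n) (hX_orbit_2178_11 n) (hX_orbit_2178_12 n) (hX_orbit_2178_13 n) x y z h1 h2

end Summit.Ventures.AbcSig
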